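import Summits.ValiantsHypothesis.ValiantsHypothesis.Theorems.NewtonFramesTwoProductsFrameRungTwoNoParallelogram
import Summits.ValiantsHypothesis.ValiantsHypothesis.Theorems.NewtonFramesTwoProductsFrameRungTwoSymmDiff

/-!
# Crux `TwoProducts` (stmt-5906), line `FrameRungTwo`: the RUNG at `k ≤ 2` and (SD) for parallelogram-free frames

Registered forward line `Cruxes/TwoProducts/Lines/FrameRungTwo.lean`: rung `FrameRungTwo` = `k` products of `m` bivariate
polynomials on TWO dissociated frames have `≤ (m t + 2)^{C(k)}` Newton vertices (ALL vertices).  With the landed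
`stub_classHull` (p579112), `stub_faceCount` (p580655) and the line's composition, the rung at a given `k` follows from the
cross-cancelling count at that `k`; `…FrameRungTwoNoParallelogram.lean` (p597385) proved that count for `k ≤ 2` on frames
without parallelogram coincidences.  This file assembles:

* `frameRungTwo_le_two_of_noParallelogram` — the RUNG's conclusion for `k ≤ 2` products, any `m, t`, on pairs of dissociated
  frames without parallelogram coincidences: `#vert Newt(Σ_i Π_j f i j) ≤ (m t + 2)^C` (the line file's composition
  `FrameRungTwo_of`, reproduced as in `…FrameRungTwoSymmDiff.lean`, fed with p579112, p580655, p597385);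
* `symmDiff_noParallelogram_le` — the algebra-free core (SD) for such pairs: `#vert conv(S_A ∆ S_B) ≤ (m t + 2)^C`
  (all-ones design, as in `symmDiff_bound_of_frameRungTwo`).

At `k = 2` this is a new unconditional family of the crux `TwoProducts` with a budget POLYNOMIAL in `m` and `t`: two products
on generic (parallelogram-free) dissociated frames; together with `…TwoProductsAPSupports.lean` (arithmetic-progression
supports) it leaves, at `k = 2`, only non-AP frames with carries.  Honest scope: a rung strictly below the crux, at `k ≤ 2`;
nothing here bears on the crux in general (`k = 2` with arbitrary coinciding exponents) or on `VP ≠ VNP`.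
[ours; setting KPTT arXiv:1308.2286 §2, §5]
-/

set_option linter.dupNamespace false

namespace Summit.ValiantsHypothesis.ValiantsHypothesis.Theorems.NewtonFramesTwoProducts.FrameRungTwoTrinomial

open MvPolynomial
open scoped BigOperators Classical symmDiff
open Summit.ValiantsHypothesis.ValiantsHypothesis.Theorems.DissociatedFixedK.Negative (emb emb_injective)
open Summit.ValiantsHypothesis.ValiantsHypothesis.Theorems.NewtonFramesTwoProducts.FrameRungTwoSymmDiff
  (support_sum_monomial_subset support_allOnes sum_split_fin_two count_arith)

noncomputable section

/-- **The rung `FrameRungTwo` at `k ≤ 2` for parallelogram-free frames.**  For `k ≤ 2` products of `m` bivariate polynomials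
drawn from two dissociated frames with `≤ t` letters per coordinate, each frame without parallelogram coincidences, the
Newton polygon of the sum has `≤ (m t + 2)^C` vertices (`C = C₁(k) + 9`, `C₁` the floor's exponent). [ours] -/
theorem frameRungTwo_le_two_of_noParallelogram : ∀ k ≤ 2, ∃ C : ℕ, ∀ (m t : ℕ)
    (A : Fin 2 → Fin m → Finset (Fin 2 →₀ ℕ)) (c : Fin k → Fin 2) (f : Fin k → Fin m → MvPolynomial (Fin 2) ℂ),
    (∀ σ j, (A σ j).card ≤ t) →
    (∀ i j, (f i j).support ⊆ A (c i) j) →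
    (∀ σ, ∀ a b : Fin m → (Fin 2 →₀ ℕ), (∀ j, a j ∈ A σ j) → (∀ j, b j ∈ A σ j) →
        ∑ j, a j = ∑ j, b j → a = b) →
    (∀ σ, ∀ (a a' : Fin m → (Fin 2 →₀ ℕ)) (p : Fin m) (x y : Fin 2 →₀ ℕ), (∀ j, a j ∈ A σ j) → (∀ j, a' j ∈ A σ j) →
        x ∈ A σ p → y ∈ A σ p → x ≠ y → x ≠ a' p → y ≠ a' p → (∑ j, a j) + a' p + a' p ≠ (∑ j, a' j) + x + y) →
    (Set.extremePoints ℝ (convexHull ℝ (emb '' ((∑ i, ∏ j, f i j).support : Set (Fin 2 →₀ ℕ))))).ncard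
      ≤ (m * t + 2) ^ C := by
  intro k hk
  obtain ⟨C₁, hC₁⟩ := FrameRungTwoClassHull.stub_classHull k
  obtain ⟨C₂, hC₂⟩ := crossCancelCount_le_two_of_noParallelogram k hk
  refine ⟨C₁ + C₂ + 3, ?_⟩
  intro m t A c f hA hf hinj hpar
  have hcls := hC₁ m t A c f hA hf hinj
  have hcross := hC₂ m t A c f hA hf hinj hpar
  set F : MvPolynomial (Fin 2) ℂ := ∑ i, ∏ j, f i j with hF
  set F₀ : MvPolynomial (Fin 2) ℂ := ∑ i ∈ Finset.univ.filter (fun i => c i = 0), ∏ j, f i j with hF₀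
  set F₁ : MvPolynomial (Fin 2) ℂ := ∑ i ∈ Finset.univ.filter (fun i => c i = 1), ∏ j, f i j with hF₁
  set X : Set (Fin 2 → ℝ) := emb '' (F.support : Set (Fin 2 →₀ ℕ)) with hX
  set Y₀ : Set (Fin 2 → ℝ) := emb '' (F₀.support : Set (Fin 2 →₀ ℕ)) with hY₀
  set Y₁ : Set (Fin 2 → ℝ) := emb '' (F₁.support : Set (Fin 2 →₀ ℕ)) with hY₁
  have hXfin : X.Finite := F.support.finite_toSet.image emb
  have hY₀fin : Y₀.Finite := F₀.support.finite_toSet.image emb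
  have hY₁fin : Y₁.Finite := F₁.support.finite_toSet.image emb
  have hsplit : F = F₀ + F₁ := sum_split_fin_two c (fun i => ∏ j, f i j)
  have hXY : X ⊆ Y₀ ∪ Y₁ := by
    intro q hq
    obtain ⟨e, he, rfl⟩ := hq
    have he' : e ∈ (F₀ + F₁).support := by rw [← hsplit]; exact he
    rcases Finset.mem_union.1 (MvPolynomial.support_add he') with h0 | h1
    · exact Or.inl ⟨e, h0, rfl⟩
    · exact Or.inr ⟨e, h1, rfl⟩
  have hface := FrameRungTwoFaceCount.stub_faceCount X Y₀ Y₁ hXfin hY₀fin hY₁fin hXY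
  set V : Set (Fin 2 → ℝ) := Set.extremePoints ℝ (convexHull ℝ X) with hV
  set Pfree : Set (Fin 2 → ℝ) := {p : Fin 2 → ℝ | p ∈ V ∧
      ∃ l : (Fin 2 → ℝ) →ₗ[ℝ] ℝ, (∀ q ∈ X, q ≠ p → l q < l p) ∧ (∀ q ∈ Y₀ ∪ Y₁, l q ≤ l p)} with hPfree
  set Pcross : Set (Fin 2 → ℝ) := {p : Fin 2 → ℝ | p ∈ V ∧
      ∃ l : (Fin 2 → ℝ) →ₗ[ℝ] ℝ, (∀ q ∈ X, q ≠ p → l q < l p) ∧ ∃ q ∈ Y₀ ∪ Y₁, l p < l q} with hPcross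
  have hVsub : V ⊆ Pfree ∪ Pcross := by
    intro p hp
    obtain ⟨l, hl⟩ :=
      Summit.ValiantsHypothesis.ValiantsHypothesis.Theorems.TwoProducts.Negative.exists_strict_exposing_of_finite
        hXfin hp
    by_cases hall : ∀ q ∈ Y₀ ∪ Y₁, l q ≤ l p
    · exact Or.inl ⟨hp, l, hl, hall⟩
    · push Not at hall
      obtain ⟨q, hq, hlt⟩ := hall
      exact Or.inr ⟨hp, l, hl, q, hq, hlt⟩
  have hVfin : V.Finite := hXfin.subset extremePoints_convexHull_subset
  have hPfin : (Pfree ∪ Pcross).Finite :=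
    hVfin.subset (Set.union_subset (fun p hp => hp.1) (fun p hp => hp.1))
  have hx : 2 ≤ m * t + 2 := by omega
  calc V.ncard ≤ (Pfree ∪ Pcross).ncard := Set.ncard_le_ncard hVsub hPfin
    _ ≤ Pfree.ncard + Pcross.ncard := Set.ncard_union_le _ _
    _ ≤ 2 * ((Set.extremePoints ℝ (convexHull ℝ Y₀)).ncard
            + (Set.extremePoints ℝ (convexHull ℝ Y₁)).ncard) + (m * t + 2) ^ C₂ :=
        Nat.add_le_add hface hcross
    _ ≤ 2 * ((m * t + 2) ^ C₁ + (m * t + 2) ^ C₁) + (m * t + 2) ^ C₂ := by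
        gcongr
        · exact hcls 0
        · exact hcls 1
    _ ≤ (m * t + 2) ^ (C₁ + C₂ + 3) := count_arith _ _ _ hx

/-- **(SD) for parallelogram-free frames.**  For two dissociated frames `A, B` (`m` coordinates, `≤ t` letters each) without
parallelogram coincidences, the convex hull of the symmetric difference of the two sumsets has `≤ (m t + 2)^C` vertices
(the all-ones instance of `frameRungTwo_le_two_of_noParallelogram`, `k = 2`). [ours] -/
theorem symmDiff_noParallelogram_le : ∃ C : ℕ, ∀ (m t : ℕ) (A B : Fin m → Finset (Fin 2 →₀ ℕ)),
    (∀ j, (A j).card ≤ t) → (∀ j, (B j).card ≤ t) →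
    (∀ a b : Fin m → (Fin 2 →₀ ℕ), (∀ j, a j ∈ A j) → (∀ j, b j ∈ A j) → ∑ j, a j = ∑ j, b j → a = b) →
    (∀ a b : Fin m → (Fin 2 →₀ ℕ), (∀ j, a j ∈ B j) → (∀ j, b j ∈ B j) → ∑ j, a j = ∑ j, b j → a = b) →
    (∀ (a a' : Fin m → (Fin 2 →₀ ℕ)) (p : Fin m) (x y : Fin 2 →₀ ℕ), (∀ j, a j ∈ A j) → (∀ j, a' j ∈ A j) →
        x ∈ A p → y ∈ A p → x ≠ y → x ≠ a' p → y ≠ a' p → (∑ j, a j) + a' p + a' p ≠ (∑ j, a' j) + x + y) →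
    (∀ (a a' : Fin m → (Fin 2 →₀ ℕ)) (p : Fin m) (x y : Fin 2 →₀ ℕ), (∀ j, a j ∈ B j) → (∀ j, a' j ∈ B j) →
        x ∈ B p → y ∈ B p → x ≠ y → x ≠ a' p → y ≠ a' p → (∑ j, a j) + a' p + a' p ≠ (∑ j, a' j) + x + y) →
    (Set.extremePoints ℝ (convexHull ℝ (emb ''
      ↑(((Fintype.piFinset A).image (fun a => ∑ j, a j)) ∆ ((Fintype.piFinset B).image (fun b => ∑ j, b j)))))).ncard
      ≤ (m * t + 2) ^ C := by
  obtain ⟨K, hK⟩ := frameRungTwo_le_two_of_noParallelogram 2 le_rfl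
  refine ⟨K, fun m t A B hAt hBt hA hB hpA hpB => ?_⟩
  rcases Nat.eq_zero_or_pos m with hm | hm
  · subst hm
    have h0 : ((Fintype.piFinset A).image (fun a => ∑ j, a j)) ∆ ((Fintype.piFinset B).image (fun b => ∑ j, b j))
        = ∅ := by
      have e0 : ∀ A' : Fin 0 → Finset (Fin 2 →₀ ℕ), (Fintype.piFinset A').image (fun a => ∑ j, a j) = {0} := by
        intro A'
        refine Finset.eq_singleton_iff_unique_mem.mpr ⟨?_, ?_⟩
        · exact Finset.mem_image.mpr
            ⟨fun j => Fin.elim0 j, Fintype.mem_piFinset.mpr (fun j => Fin.elim0 j), by simp⟩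
        · intro e he
          obtain ⟨a, -, rfl⟩ := Finset.mem_image.mp he
          simp
      rw [e0 A, e0 B, symmDiff_self]
      rfl
    rw [h0, Finset.coe_empty, Set.image_empty, convexHull_empty]
    simp
  · set j₀ : Fin m := ⟨0, hm⟩ with hj₀
    set PA : Fin m → MvPolynomial (Fin 2) ℂ := fun j => ∑ α ∈ A j, monomial α (1 : ℂ) with hPA
    set QB : Fin m → MvPolynomial (Fin 2) ℂ := fun j => ∑ β ∈ B j, monomial β (1 : ℂ) with hQB
    set s : Fin m → ℂ := fun j => if j = j₀ then -1 else 1 with hs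
    set A2 : Fin 2 → Fin m → Finset (Fin 2 →₀ ℕ) := fun σ => if σ = 0 then A else B with hA2
    set f : Fin 2 → Fin m → MvPolynomial (Fin 2) ℂ :=
      fun σ j => if σ = 0 then PA j else C (s j) * QB j with hf
    have h10 : (1 : Fin 2) ≠ 0 := by decide
    have hcard : ∀ σ j, (A2 σ j).card ≤ t := by
      intro σ j
      by_cases hσ : σ = 0
      · simp only [hA2, hσ, if_true]; exact hAt j
      · simp only [hA2, hσ, if_false]; exact hBt j
    have hsupp : ∀ i j, (f i j).support ⊆ A2 ((fun i : Fin 2 => i) i) j := by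
      intro i j
      by_cases hi : i = 0
      · simp only [hf, hA2, hi, if_true]
        exact support_sum_monomial_subset (A j)
      · simp only [hf, hA2, hi, if_false]
        intro e he
        rw [mem_support_iff, coeff_C_mul] at he
        have hq : coeff e (QB j) ≠ 0 := fun h0 => he (by rw [h0, mul_zero])
        exact support_sum_monomial_subset (B j) (mem_support_iff.mpr hq)
    have hinj : ∀ σ, ∀ a b : Fin m → (Fin 2 →₀ ℕ), (∀ j, a j ∈ A2 σ j) → (∀ j, b j ∈ A2 σ j) →
        ∑ j, a j = ∑ j, b j → a = b := by
      intro σ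
      by_cases hσ : σ = 0
      · simp only [hA2, hσ, if_true]; exact hA
      · simp only [hA2, hσ, if_false]; exact hB
    have hpar : ∀ σ, ∀ (a a' : Fin m → (Fin 2 →₀ ℕ)) (p : Fin m) (x y : Fin 2 →₀ ℕ), (∀ j, a j ∈ A2 σ j) →
        (∀ j, a' j ∈ A2 σ j) → x ∈ A2 σ p → y ∈ A2 σ p → x ≠ y → x ≠ a' p → y ≠ a' p →
        (∑ j, a j) + a' p + a' p ≠ (∑ j, a' j) + x + y := by
      intro σ
      by_cases hσ : σ = 0
      · simp only [hA2, hσ, if_true]; exact hpA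
      · simp only [hA2, hσ, if_false]; exact hpB
    have key := hK m t A2 (fun i => i) f hcard hsupp hinj hpar
    have hprodB : ∏ j, f 1 j = -∏ j, QB j := by
      have e1 : ∀ j, f 1 j = C (s j) * QB j := fun j => by simp only [hf, h10, if_false]
      simp_rw [e1]
      rw [Finset.prod_mul_distrib, ← map_prod C]
      have hsprod : ∏ j, s j = -1 := by
        simp only [hs]
        rw [Finset.prod_ite_eq']
        simp
      rw [hsprod, map_neg, map_one, neg_one_mul]
    have hsum : (∑ i, ∏ j, f i j) = (∏ j, PA j) - ∏ j, QB j := by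
      rw [Fin.sum_univ_two, hprodB, ← sub_eq_add_neg]
      simp only [hf, if_true]
    rw [hsum, support_allOnes A B hA hB] at key
    exact key

end

end Summit.ValiantsHypothesis.ValiantsHypothesis.Theorems.NewtonFramesTwoProducts.FrameRungTwoTrinomial
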